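import Mathlib
import Literature.AlgebraicGeometry.Resolution.CobordantGame
import Literature.AlgebraicGeometry.Resolution.FormalCoordinateChange
import Literature.AlgebraicGeometry.Resolution.CobordantChartCoefficients
import Literature.AlgebraicGeometry.Resolution.PowerSeriesRegularLocal
import Summits.ResolutionOfSingularities.ResolutionOfSingularities.Theorems.WeightedInvariantGlobalizeLocalDropCanonize
import Summits.ResolutionOfSingularities.ResolutionOfSingularities.Theorems.WeightedInvariantGlobalizeLocalDropCylinder
import Summits.ResolutionOfSingularities.ResolutionOfSingularities.Theorems.WeightedInvariantGlobalizeLocalDropRegularGerms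
import Summits.ResolutionOfSingularities.ResolutionOfSingularities.Theorems.WeightedInvariantLocalWeightedDropHornedRankEquiv

/-!
# `WeightedInvariant.LocalWeightedDrop`, line `hasse-ridge-face-selection`: the double-point lift

Crux item stmt-ResolutionOfSingularities-8899 (route `ResolutionOfSingularities/WeightedInvariant`), skeleton v7 of
the line, stub `stub_doublePointLiftPlane`: over an algebraically closed field of characteristic `p ≠ 2`, a rank `κ`
on plane germs dropping along the PLANE BRANCH GAME (legal plane coordinate change `Φ`, weights `w ∈ {0,1}² ∖ 0`; at
an exceptional point `c ≠ 0` with `b∘Φ(chart) = sᵃ·G`, `s ∤ G`, some slot `i` with `cᵢ ≠ 0` has the parity-twisted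
slice `S = (s^{a mod 2}·G)|_{yᵢ = 0}` of smaller rank whenever `S ∈ 𝔪²`) lifts to the crux's game
(`Literature.….CobordantGame`) on the surface double points: `Won k 3 (x₀² + b(x₁, x₂))` for every `b ∈ 𝔪² ∖ 0`.
Proof (move mirroring; internally the square sits in the LAST slot, `b(x₀,x₁) + x₂²`, a shape reproducing itself
on successors up to a cylinder; the registered spelling is a slot rotation away, `DoublePointLift.won_registered`):
induction on `κ b`; mirror the branch move as `Θ = (Φ, x₂)` with weights `(w, ⌊D/2⌋)`, `D = ord_w(b∘Φ)`; the
transform at `(c, c₂)` is `s^{2⌊D/2⌋}(γ + y₃)² + (transform of b∘Φ at c)`, `γ = c₂` (`transform_eq`), the `b`-part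
being `s^D·G`, `s ∤ G`, at every point (`CobordantChart.eq_weightedOrder_of_factor`); a singular successor is thus
`(γ + y₃)² + g'`, `g' = s^{D mod 2}G`, with `2γ = 0`, i.e. `γ = 0` (`p ≠ 2`), and `g' ∈ 𝔪²`.  The hypothesis names
a slot `i` with `cᵢ ≠ 0` (so `wᵢ = 1`: tame); the landed `tameSlice`, applied to `b∘Φ(chart) = s^{2⌊D/2⌋}·g'`,
gives `g' = u·Φ₂(cyl S)`, `S ≠ 0` the parity-twisted slice; `x² + S` is won (induction if `S ∈ 𝔪²`, outright
otherwise), hence so is `y₃² + g'`: a unit times a legal change (`Φ₂ ⊗ id`, then `y₃ ↦ v·y₃`, `v² = u` by Hensel)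
of a cylinder over `x² + S` (`won_climb`: `won_cyl`, `won_subst_iff`, `won_unit_mul_iff`).
-/

set_option linter.dupNamespace false -- mandated namespace of this single-conjunct summit

namespace Summit.ResolutionOfSingularities.ResolutionOfSingularities.Theorems

open Literature.AlgebraicGeometry.Resolution
open Literature.AlgebraicGeometry.Resolution.CobordantGame

namespace DoublePointLift

open MvPowerSeries

variable {k : Type} [Field k] {n : ℕ}

section LiftMove

variable {Φ : Fin n → MvPowerSeries (Fin n) k} {e : ℕ} {w : Fin n → ℕ}
  {Θ : Fin (n + 1) → MvPowerSeries (Fin (n + 1)) k} {W : Fin (n + 1) → ℕ}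
  (hΘ : Θ = Fin.insertNth (α := fun _ => MvPowerSeries (Fin (n + 1)) k) (Fin.last n) (X (Fin.last n))
    (fun m => rename (Fin.succAboveEmb (Fin.last n)) (Φ m)))
  (hW : W = Fin.insertNth (α := fun _ => ℕ) (Fin.last n) e w)

include hΘ hW

/-- THE TRANSFORM OF THE LIFTED MOVE `Θ = (Φ, x_n)` (square in the last slot; the move `(Φ ⊗ id)` of the cylinders of
`WeightedInvariantGlobalizeLocalDropCylinder`), weights `W = (w, e)`, at the exceptional point `c`:
`s^{2e}·(γ + y_{n+1})² + rename (transform of b under (Φ, w) at c|_{<n})`, `γ = c_n` (`0` if `e = 0`). -/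
theorem transform_eq (hΦ0 : ∀ i, constantCoeff (Φ i) = 0) (c : Fin (n + 1) → k) (b : MvPowerSeries (Fin n) k) :
    subst (cruxChart k W c) (subst Θ (X (Fin.last n) ^ 2 + rename (Fin.succAboveEmb (Fin.last n)) b)) =
      X 0 ^ (2 * e) * (C (if 0 < e then c (Fin.last n) else 0) + X (Fin.last (n + 1))) ^ 2 +
        rename (Fin.succAboveEmb (Fin.last (n + 1)))
          (subst (cruxChart k w fun m => c ((Fin.last n).succAbove m)) (subst Φ b)) := by
  have hΘs := hasSubst_of_constantCoeff_zero (hΘ ▸ constantCoeff_cylMove (Fin.last n) Φ hΦ0)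
  have hc0 := constantCoeff_cruxChart (k := k) W c
  have hs := hasSubst_of_constantCoeff_zero hc0
  have hΘL : Θ (Fin.last n) = X (Fin.last n) := by rw [hΘ, Fin.insertNth_apply_same]
  have hcL : cruxChart k W c (Fin.last n) = X 0 ^ e * (C (if 0 < e then c (Fin.last n) else 0) + X (Fin.last (n + 1))) := by
    rw [hW]
    unfold cruxChart
    rw [Fin.insertNth_apply_same]
    split_ifs with he
    · rfl
    · rw [show e = 0 by omega, pow_zero, one_mul, map_zero, zero_add]
      rfl
  -- the old slots of the chart of `W`: the chart of `w` at the projected point, renamed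
  have hcm : ∀ m : Fin n, cruxChart k W c ((Fin.succAboveEmb (Fin.last n)) m) =
      rename (Fin.succAboveEmb (Fin.last (n + 1))) (cruxChart k w (fun m => c ((Fin.last n).succAbove m)) m) := by
    intro m
    have hsc : (Fin.succAboveEmb (Fin.last (n + 1))) m.succ = ((Fin.last n).succAbove m).succ :=
      Fin.succ_succAbove_succ (Fin.last n) m
    rw [hW]
    show cruxChart k _ c ((Fin.last n).succAbove m) = _
    simp only [cruxChart, Fin.insertNth_apply_succAbove]
    split_ifs with hw
    · rw [map_mul, map_pow, map_add, rename_X, rename_C, rename_X, hsc,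
        show (Fin.succAboveEmb (Fin.last (n + 1))) (0 : Fin (n + 1)) = 0 from succAboveEmb_succ_zero (Fin.last n)]
    · rw [rename_X, hsc]
  rw [subst_add hΘs, subst_pow hΘs, subst_X hΘs, hΘL, hΘ, subst_cylMove_rename (Fin.last n) Φ hΦ0 b, subst_add hs,
    subst_pow hs, subst_X hs, hcL, subst_rename_eq _ _ hc0, rename_subst_eq _ _ (constantCoeff_cruxChart w _), mul_pow,
    ← pow_mul, mul_comm e 2]
  congr 2
  exact funext hcm

end LiftMove

section Successor

variable (γ : k) (G : MvPowerSeries (Fin (n + 1)) k) {g : MvPowerSeries (Fin (n + 1 + 1)) k}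
  (hg : g = (C γ + X (Fin.last (n + 1))) ^ 2 + rename (Fin.succAboveEmb (Fin.last (n + 1))) G)

/-- Coefficients of the renamed `G` vanish at exponents involving `y_{n+1}`. -/
theorem coeff_rename_eq_zero {d : Fin (n + 1 + 1) →₀ ℕ} (hd : d (Fin.last (n + 1)) ≠ 0) :
    coeff d (rename (Fin.succAboveEmb (Fin.last (n + 1))) G) = 0 := by
  apply MvPowerSeries.coeff_rename_eq_zero
  rintro ⟨u, rfl⟩
  exact hd (Finsupp.mapDomain_notin_range u _ fun ⟨j, hj⟩ => Fin.succAbove_ne _ j hj)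

include hg

/-- The coefficients of the `s`-saturated successor `g = (γ + y_{n+1})² + G`: those of `y_{n+1}² + 2γ·y_{n+1} + γ²`,
plus those of `G` (renamed). -/
theorem coeff_g (d : Fin (n + 1 + 1) →₀ ℕ) : coeff d g = (if d = Finsupp.single (Fin.last (n + 1)) 2 then 1 else 0) +
    2 * γ * (if d = Finsupp.single (Fin.last (n + 1)) 1 then 1 else 0) + (if d = 0 then γ ^ 2 else 0) +
      coeff d (rename (Fin.succAboveEmb (Fin.last (n + 1))) G) := by
  have hsq : (C γ + X (Fin.last (n + 1)) : MvPowerSeries (Fin (n + 1 + 1)) k) ^ 2 =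
      X (Fin.last (n + 1)) ^ 2 + C (2 * γ) * X (Fin.last (n + 1)) + C (γ ^ 2) := by
    simp only [map_mul, map_pow, map_ofNat]
    ring
  rw [hg, hsq, map_add, map_add, map_add, coeff_X_pow, coeff_C_mul, coeff_X, coeff_C]

/-- `s ∤ g`: the monomial `y_{n+1}²` of `g` survives. -/
theorem not_X_dvd_g : ¬ X 0 ∣ g := by
  intro h
  have h1 := (X_dvd_iff).mp h (Finsupp.single (Fin.last (n + 1)) 2) (by simp)
  rw [coeff_g γ G hg, if_pos rfl, if_neg (by simp [Finsupp.single_eq_single_iff]),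
    if_neg (Finsupp.single_ne_zero.mpr two_ne_zero), coeff_rename_eq_zero G (by simp)] at h1
  norm_num at h1

/-- SINGULARITY DESCENDS (`2 ≠ 0` in `k`): if `g = (γ + y_{n+1})² + G ∈ 𝔪²` then `γ = 0` and `G ∈ 𝔪²`. -/
theorem singular_descends (h2 : (2 : k) ≠ 0) (hs : constantCoeff g = 0 ∧ ∀ j, coeff (Finsupp.single j 1) g = 0) :
    γ = 0 ∧ (constantCoeff G = 0 ∧ ∀ j, coeff (Finsupp.single j 1) G = 0) := by
  obtain ⟨h0, h1⟩ := hs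
  have hγ : γ = 0 := by
    have := h1 (Fin.last (n + 1))
    rw [coeff_g γ G hg, if_neg (by simp [Finsupp.single_eq_single_iff]), if_pos rfl,
      if_neg (Finsupp.single_ne_zero.mpr one_ne_zero), coeff_rename_eq_zero G (by simp), zero_add, mul_one, add_zero,
      add_zero] at this
    exact (mul_eq_zero.mp this).resolve_left h2
  subst hγ
  refine ⟨rfl, ?_, fun j => ?_⟩
  · rwa [hg, map_add, constantCoeff_rename, map_pow, map_add, constantCoeff_C, constantCoeff_X, add_zero,
      zero_pow two_ne_zero, zero_add] at h0
  · have := h1 ((Fin.succAboveEmb (Fin.last (n + 1))) j)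
    rwa [coeff_g 0 G hg, if_neg (by simp [Finsupp.single_eq_single_iff]), if_neg (by simp [Finsupp.single_eq_single_iff]),
      if_neg (Finsupp.single_ne_zero.mpr one_ne_zero), ← Finsupp.embDomain_single, coeff_embDomain_rename, zero_add,
      mul_zero, add_zero, zero_add] at this

end Successor

/-- SQUARE ROOTS OF UNITS (`k` algebraically closed, `2 ≠ 0`): Hensel's lemma in the `𝔪`-adically complete ring
`k[[x]]` for `T² − u` at a square root of `u(0)` (a simple root as `2 ≠ 0`). -/
theorem exists_sq_eq [IsAlgClosed k] (h2 : (2 : k) ≠ 0) {m : ℕ} (u : MvPowerSeries (Fin m) k)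
    (hu : constantCoeff u ≠ 0) : ∃ v : MvPowerSeries (Fin m) k, v ^ 2 = u ∧ constantCoeff v ≠ 0 := by
  haveI : IsAdicComplete (IsLocalRing.maximalIdeal (MvPowerSeries (Fin m) k)) (MvPowerSeries (Fin m) k) := by
    rw [maximalIdeal_mvPowerSeries_eq_span k (Fin m)]
    infer_instance
  have hmem : ∀ φ : MvPowerSeries (Fin m) k, φ ∈ IsLocalRing.maximalIdeal _ ↔ constantCoeff φ = 0 := fun φ => by
    rw [IsLocalRing.mem_maximalIdeal, mem_nonunits_iff, isUnit_iff_constantCoeff, isUnit_iff_ne_zero, not_not]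
  obtain ⟨ω, hω⟩ := IsAlgClosed.exists_eq_mul_self (constantCoeff u)
  have hω0 : ω ≠ 0 := fun h => hu (by rw [hω, h, mul_zero])
  set F : Polynomial (MvPowerSeries (Fin m) k) := Polynomial.X ^ 2 - Polynomial.C u with hF
  have heval : ∀ a, F.eval a = a ^ 2 - u := fun a => by simp [F]
  have h1 : F.eval (C ω) ∈ IsLocalRing.maximalIdeal _ := by
    rw [hmem, heval, map_sub, map_pow, constantCoeff_C, hω, sq, sub_self]
  have h2' : IsUnit (Ideal.Quotient.mk (IsLocalRing.maximalIdeal _) (F.derivative.eval (C ω))) := by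
    have hder : F.derivative.eval (C ω) = 2 * C ω := by
      rw [hF, Polynomial.derivative_sub, Polynomial.derivative_C, sub_zero, Polynomial.derivative_X_pow]
      simp
    rw [hder]
    refine IsUnit.map _ ?_
    rw [isUnit_iff_constantCoeff, isUnit_iff_ne_zero, map_mul, map_ofNat, constantCoeff_C]
    exact mul_ne_zero h2 hω0
  obtain ⟨v, hroot, hv⟩ :=
    HenselianRing.is_henselian (I := IsLocalRing.maximalIdeal _) F (Polynomial.monic_X_pow_sub_C u two_ne_zero) _ h1 h2'
  rw [hmem, map_sub, sub_eq_zero, constantCoeff_C] at hv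
  exact ⟨v, by rwa [← sub_eq_zero, ← heval], hv ▸ hω0⟩

section Scale

variable {v : MvPowerSeries (Fin (n + 1)) k} {Λ : Fin (n + 1 + 1) → MvPowerSeries (Fin (n + 1 + 1)) k}
  (hΛ : Λ = Fin.insertNth (α := fun _ => MvPowerSeries (Fin (n + 1 + 1)) k) (Fin.last (n + 1))
    (rename (Fin.succAboveEmb (Fin.last (n + 1))) v * X (Fin.last (n + 1)))
    (fun m => X ((Fin.succAboveEmb (Fin.last (n + 1))) m)))

include hΛ

/-- The scaling `Λ : y_{n+1} ↦ v·y_{n+1}` (`v` renamed into the old slots), identity on the old slots, has zero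
constant terms. -/
theorem constantCoeff_scale (i : Fin (n + 1 + 1)) : constantCoeff (Λ i) = 0 := by
  subst hΛ
  rcases Fin.eq_self_or_eq_succAbove (Fin.last (n + 1)) i with rfl | ⟨m, rfl⟩
  · rw [Fin.insertNth_apply_same, map_mul, constantCoeff_X, mul_zero]
  · rw [Fin.insertNth_apply_succAbove, constantCoeff_X]

/-- The scaling fixes every series in the old slots. -/
theorem subst_scale_rename (F : MvPowerSeries (Fin (n + 1)) k) :
    subst Λ (rename (Fin.succAboveEmb (Fin.last (n + 1))) F) = rename (Fin.succAboveEmb (Fin.last (n + 1))) F := by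
  rw [subst_rename_eq _ _ (constantCoeff_scale hΛ) F, rename_eq_subst, hΛ]
  congr 1
  exact funext fun m => Fin.insertNth_apply_succAbove (Fin.last (n + 1)) _ _ m

/-- The scaling multiplies the square's coordinate by the (renamed) `v`. -/
theorem subst_scale_X : subst Λ (X (Fin.last (n + 1)) : MvPowerSeries (Fin (n + 1 + 1)) k) =
    rename (Fin.succAboveEmb (Fin.last (n + 1))) v * X (Fin.last (n + 1)) := by
  rw [subst_X (hasSubst_of_constantCoeff_zero (constantCoeff_scale hΛ)), hΛ]
  exact Fin.insertNth_apply_same (Fin.last (n + 1)) _ _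

end Scale

/-- The scaling by a unit `v` is a legal coordinate change (its inverse is the scaling by `v⁻¹`). -/
theorem isUnit_det_scale {v : MvPowerSeries (Fin (n + 1)) k} (hv : constantCoeff v ≠ 0) :
    IsUnit (FormalCoordChange.linMat (Fin.insertNth (α := fun _ => MvPowerSeries (Fin (n + 1 + 1)) k) (Fin.last (n + 1))
      (rename (Fin.succAboveEmb (Fin.last (n + 1))) v * X (Fin.last (n + 1)))
      (fun m => X ((Fin.succAboveEmb (Fin.last (n + 1))) m)))).det := by
  have hs := hasSubst_of_constantCoeff_zero (constantCoeff_scale (v := v) rfl)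
  refine isUnit_det_linMat_of_comp_eq_X (φ := Fin.insertNth (α := fun _ => MvPowerSeries (Fin (n + 1 + 1)) k)
    (Fin.last (n + 1)) (rename (Fin.succAboveEmb (Fin.last (n + 1))) v⁻¹ * X (Fin.last (n + 1)))
    (fun m => X ((Fin.succAboveEmb (Fin.last (n + 1))) m))) (constantCoeff_scale rfl) fun s => ?_
  rcases Fin.eq_self_or_eq_succAbove (Fin.last (n + 1)) s with rfl | ⟨m, rfl⟩
  · rw [Fin.insertNth_apply_same, subst_mul hs, subst_scale_rename rfl, subst_scale_X rfl, ← mul_assoc, ← map_mul,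
      MvPowerSeries.inv_mul_cancel v hv, map_one, one_mul]
  · rw [Fin.insertNth_apply_succAbove, subst_X hs]
    exact Fin.insertNth_apply_succAbove (Fin.last (n + 1)) _ _ m

/-- THE CLIMB: if `y_{n+1}² + h` is won (`h` in the old slots) then so is `y_{n+1}² + u·Ψ(h)` for every unit `u` and
legal coordinate change `Ψ` of the old slots — it is `(rename u) · Λ(y_{n+1}² + h)` up to the legal change `Ψ ⊗ id`,
`Λ` the scaling `y_{n+1} ↦ v·y_{n+1}` with `v² = u` (`exists_sq_eq`). -/
theorem won_climb [IsAlgClosed k] (h2 : (2 : k) ≠ 0) (h : MvPowerSeries (Fin (n + 1)) k)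
    {u : MvPowerSeries (Fin (n + 1)) k} (hu : constantCoeff u ≠ 0) {Ψ : Fin (n + 1) → MvPowerSeries (Fin (n + 1)) k}
    (hΨ0 : ∀ j, constantCoeff (Ψ j) = 0)
    (hΨdet : IsUnit (Matrix.det (Matrix.of fun j l => coeff (Finsupp.single l 1) (Ψ j))))
    (hW : Won k (n + 1 + 1) (X (Fin.last (n + 1)) ^ 2 + rename (Fin.succAboveEmb (Fin.last (n + 1))) h)) :
    Won k (n + 1 + 1) (X (Fin.last (n + 1)) ^ 2 + rename (Fin.succAboveEmb (Fin.last (n + 1))) (u * subst Ψ h)) := by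
  -- (1) the coordinate change `Ψ ⊗ id`
  have hΛ0 := constantCoeff_cylMove (k := k) (Fin.last (n + 1)) Ψ hΨ0
  have hΛdet : IsUnit (FormalCoordChange.linMat (Fin.insertNth (α := fun _ => MvPowerSeries (Fin (n + 1 + 1)) k)
      (Fin.last (n + 1)) (X (Fin.last (n + 1))) (fun m => rename (Fin.succAboveEmb (Fin.last (n + 1))) (Ψ m)))).det := by
    change IsUnit (Matrix.det (Matrix.of fun i j => coeff (Finsupp.single j 1) _))
    rw [det_linMat_cylMove]
    exact hΨdet
  have hΛs := hasSubst_of_constantCoeff_zero hΛ0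
  have hW1 : Won k (n + 1 + 1) (X (Fin.last (n + 1)) ^ 2 + rename (Fin.succAboveEmb (Fin.last (n + 1))) (subst Ψ h)) := by
    have := (won_subst_iff hΛ0 hΛdet _).mpr hW
    rwa [subst_add hΛs, subst_pow hΛs, subst_X hΛs, Fin.insertNth_apply_same,
      subst_cylMove_rename (Fin.last (n + 1)) Ψ hΨ0 h] at this
  -- (2) a square root `v` of `u`, the unit `rename u` and the scaling `y_{n+1} ↦ v·y_{n+1}`
  obtain ⟨v, hv2, hv0⟩ := exists_sq_eq h2 u hu
  have hU : constantCoeff (rename (Fin.succAboveEmb (Fin.last (n + 1))) u) ≠ 0 := by rwa [constantCoeff_rename]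
  have hs := hasSubst_of_constantCoeff_zero (constantCoeff_scale (v := v) rfl)
  refine (won_subst_iff (constantCoeff_scale rfl) (isUnit_det_scale hv0) _).mp ?_
  rw [subst_add hs, subst_pow hs, subst_scale_X rfl, subst_scale_rename rfl, map_mul, mul_pow, ← map_pow, hv2, ← mul_add]
  exact (won_unit_mul_iff hU _).mpr hW1

/-- THE SHAPE REPRODUCES UP TO A CYLINDER: the cylinder along the slot `i + 1` of `x_n² + S(x_{<n})` is
`y_{n+1}² + (cylinder along yᵢ₊₁ of S, in the old slots)`. -/
theorem rename_cyl_sq (i : Fin n) (S : MvPowerSeries (Fin n) k) :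
    rename (Fin.succAboveEmb (Fin.castSucc i.succ)) (X (Fin.last n) ^ 2 + rename (Fin.succAboveEmb (Fin.last n)) S) =
      X (Fin.last (n + 1)) ^ 2 + rename (Fin.succAboveEmb (Fin.last (n + 1))) (rename (Fin.succAboveEmb i.succ) S) := by
  have h2 : (⇑(Fin.succAboveEmb (Fin.castSucc i.succ)) ∘ ⇑(Fin.succAboveEmb (Fin.last n)) : Fin n → Fin (n + 1 + 1)) =
      ⇑(Fin.succAboveEmb (Fin.last (n + 1))) ∘ ⇑(Fin.succAboveEmb i.succ) := by
    funext m
    simp only [Function.comp_apply, Fin.coe_succAboveEmb, Fin.succAbove_last, Fin.castSucc_succAbove_castSucc]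
  rw [map_add, map_pow, rename_X, show (Fin.succAboveEmb (Fin.castSucc i.succ)) (Fin.last n) = Fin.last (n + 1) from
    Fin.succAbove_ne_last_last (Fin.castSucc_lt_last _).ne, rename_rename, rename_rename]
  simp only [h2]

/-- THE REGISTERED SPELLING: the rotation of the slots `(0, 1, 2) ↦ (1, 2, 0)` (a legal coordinate change,
`won_subst_iff`) carries `x₂² + b(x₀, x₁)` to `x₀² + b(x₁, x₂)`. -/
theorem won_registered {b : MvPowerSeries (Fin 2) k}
    (hW : Won k 3 (X (Fin.last 2) ^ 2 + rename (Fin.succAboveEmb (Fin.last 2)) b)) :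
    Won k 3 (X (0 : Fin 3) ^ 2 + rename (Fin.succEmb 2) b) := by
  set φ : Fin 3 → MvPowerSeries (Fin 3) k := fun i => X (![1, 2, 0] i) with hφ
  have h0 : ∀ i, constantCoeff (φ i) = 0 := fun i => constantCoeff_X _
  have hs := hasSubst_of_constantCoeff_zero h0
  have hdet : IsUnit (FormalCoordChange.linMat φ).det := by
    refine isUnit_det_linMat_of_comp_eq_X (φ := fun i => X (![2, 0, 1] i)) h0 fun s => ?_
    rw [subst_X hs]
    fin_cases s <;> rfl
  have key : subst φ (X (Fin.last 2) ^ 2 + rename (Fin.succAboveEmb (Fin.last 2)) b) =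
      X (0 : Fin 3) ^ 2 + rename (Fin.succEmb 2) b := by
    rw [subst_add hs, subst_pow hs, subst_X hs, subst_rename_eq _ _ h0 b, rename_eq_subst]
    congr 2
    funext m
    fin_cases m <;> rfl
  rw [← key]
  exact (won_subst_iff h0 hdet _).mpr hW

end DoublePointLift

open DoublePointLift MvPowerSeries in
/-- DOUBLE-POINT LIFT FOR SURFACE GERMS (characteristic `p ≠ 2`, `k` algebraically closed).  A RANK FOR THE PLANE BRANCH
GAME lifts to the crux's game on the double points over plane germs: if `κ` drops along the branch game — positions:
plane germs `b ∈ 𝔪² ∖ 0`; moves: a legal plane coordinate change `Φ` and weights `w ∈ {0,1}² ∖ {0}`; at an exceptional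
point `c ≠ 0` (zero on weight-`0` slots) with `b∘Φ(chart) = sᵃ·G`, `s ∤ G`, some slot `i` with `cᵢ ≠ 0` has the
PARITY-TWISTED SLICE `S = (s^{a mod 2}·G)|_{yᵢ = 0}` of smaller rank whenever `S ∈ 𝔪²` — then `x₀² + b` is won for every
plane germ `b ∈ 𝔪² ∖ 0` (induction on `κ b` in the internal spelling `x₂² + b(x₀, x₁)`, see the module docstring;
then the slot rotation `DoublePointLift.won_registered`). -/
theorem stub_doublePointLiftPlane : ∀ (p : ℕ), p.Prime → p ≠ 2 → ∀ (k : Type) [Field k] [CharP k p] [IsAlgClosed k],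
    (∃ κ : MvPowerSeries (Fin 2) k → Ordinal.{0}, ∀ b : MvPowerSeries (Fin 2) k, b ≠ 0 →
      (MvPowerSeries.constantCoeff b = 0 ∧ ∀ j, MvPowerSeries.coeff (Finsupp.single j 1) b = 0) →
      ∃ (Φ : Fin 2 → MvPowerSeries (Fin 2) k) (w : Fin 2 → ℕ),
        (∀ i, MvPowerSeries.constantCoeff (Φ i) = 0) ∧
        IsUnit (Matrix.det (Matrix.of fun i j => MvPowerSeries.coeff (Finsupp.single j 1) (Φ i))) ∧
        (∀ i, w i ≤ 1) ∧ (∃ i, 0 < w i) ∧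
        ∀ (c : Fin 2 → k), (∀ i, w i = 0 → c i = 0) → c ≠ 0 →
        ∀ (a : ℕ) (G : MvPowerSeries (Fin 3) k),
          MvPowerSeries.subst (CobordantChart.chart w c) (MvPowerSeries.subst Φ b) = MvPowerSeries.X 0 ^ a * G →
          ¬ (MvPowerSeries.X (0 : Fin 3) ∣ G) →
          ∃ i : Fin 2, c i ≠ 0 ∧ ∀ S : MvPowerSeries (Fin 2) k,
            S = MvPowerSeries.subst (fun j : Fin 3 => if j = i.succ then (0 : MvPowerSeries (Fin 2) k)
                  else MvPowerSeries.X (Fin.predAbove i j)) (MvPowerSeries.X 0 ^ (a % 2) * G) →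
            (MvPowerSeries.constantCoeff S = 0 ∧ ∀ j, MvPowerSeries.coeff (Finsupp.single j 1) S = 0) →
            κ S < κ b) →
    ∀ b : MvPowerSeries (Fin 2) k, b ≠ 0 →
    (MvPowerSeries.constantCoeff b = 0 ∧ ∀ j, MvPowerSeries.coeff (Finsupp.single j 1) b = 0) →
    CobordantGame.Won k 3 (MvPowerSeries.X (0 : Fin 3) ^ 2 + MvPowerSeries.rename (Fin.succEmb 2) b) := by
  intro p hp hp2 k _ _ _ hκ b hb0 hbm
  obtain ⟨κ, hκ⟩ := hκ
  have h2 : (2 : k) ≠ 0 := fun h => hp2 ((Nat.prime_dvd_prime_iff_eq hp Nat.prime_two).mp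
    ((CharP.cast_eq_zero_iff k p 2).mp (by exact_mod_cast h)))
  -- induction on `κ b`, in the internal spelling `x₂² + b(x₀, x₁)`
  suffices key : ∀ (α : Ordinal.{0}) (b : MvPowerSeries (Fin 2) k), κ b = α → b ≠ 0 →
      (constantCoeff b = 0 ∧ ∀ j, coeff (Finsupp.single j 1) b = 0) →
      Won k 3 (X (Fin.last 2) ^ 2 + rename (Fin.succAboveEmb (Fin.last 2)) b) from won_registered (key _ b rfl hb0 hbm)
  intro α
  induction α using WellFoundedLT.induction with
  | ind α ih =>
  intro b hα hb0 hbm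
  obtain ⟨Φ, w, hΦ0, hdet, hw1, ⟨i₀, hi₀⟩, hdrop⟩ := hκ b hb0 hbm
  have hB : subst Φ b ≠ 0 := FormalCoordChange.subst_ne_zero_of_isUnit_det hΦ0 hdet hb0
  obtain ⟨D, hD⟩ : ∃ D : ℕ, (D : ℕ∞) = (subst Φ b).weightedOrder w := ⟨_, (ne_zero_iff_weightedOrder_finite w).mp hB⟩
  -- THE MOVE `Θ = (Φ, x₂)`, `W = (w, ⌊D/2⌋)` (legal: `det_linMat_cylMove`); a successor `g` at the exceptional point `pt`
  set Θ : Fin 3 → MvPowerSeries (Fin 3) k := Fin.insertNth (α := fun _ => MvPowerSeries (Fin 3) k) (Fin.last 2)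
    (X (Fin.last 2)) (fun m => rename (Fin.succAboveEmb (Fin.last 2)) (Φ m)) with hΘ
  set W : Fin 3 → ℕ := Fin.insertNth (α := fun _ => ℕ) (Fin.last 2) (D / 2) w with hW
  refine Won.move Θ W ⟨hΘ ▸ constantCoeff_cylMove (Fin.last 2) Φ hΦ0, by rw [hΘ, det_linMat_cylMove]; exact hdet,
    (Fin.last 2).succAbove i₀, by rwa [hW, Fin.insertNth_apply_succAbove]⟩ ?_
  rintro g ⟨pt, a', hoff, hfac, hndvd, hsing⟩
  rw [transform_eq hΘ hW hΦ0 pt b] at hfac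
  set γ : k := (if 0 < D / 2 then pt (Fin.last 2) else 0) with hγ
  -- the `b`-part of the transform is `s^D · G`, `s ∤ G`, at the projected point `c''` (with the convention)
  set c' : Fin 2 → k := fun m => pt ((Fin.last 2).succAbove m) with hc'
  set c'' : Fin 2 → k := fun m => if 0 < w m then c' m else 0 with hc''
  have hconv : ∀ m, w m = 0 → c'' m = 0 := fun m hm => by simp [hc'', hm]
  have hcc : cruxChart k w c' = CobordantChart.chart w c'' := CobordantChart.cruxChart_eq_chart w c'
  obtain ⟨a₁, G, hTfac, hG⟩ := exists_eq_X_pow_mul_not_dvd 0 (CobordantChart.subst_chart_ne_zero w c'' hconv hB)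
  have ha₁ := CobordantChart.eq_weightedOrder_of_factor w c'' hconv hB hTfac hG
  rw [← hD, Nat.cast_inj] at ha₁
  rw [ha₁] at hTfac
  have hfac2 : subst (CobordantChart.chart w c'') (subst Φ b) = X 0 ^ (2 * (D / 2)) * (X 0 ^ (D % 2) * G) := by
    rw [hTfac, ← mul_assoc, ← pow_add, Nat.div_add_mod]
  rw [hcc, hfac2, map_mul, map_pow, rename_X, show (Fin.succAboveEmb (Fin.last (2 + 1))) (0 : Fin (2 + 1)) = 0 from
    succAboveEmb_succ_zero (Fin.last 2), ← mul_add] at hfac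
  -- uniqueness of the `s`-adic factorisation: `g = (γ + y₃)² + s^{D mod 2}·G`; singularity descends, `γ = 0`
  obtain ⟨-, rfl⟩ := X_pow_mul_eq_X_pow_mul 0 hfac (not_X_dvd_g γ _ rfl) hndvd
  obtain ⟨hγ0, hg'⟩ := singular_descends γ _ rfl h2 hsing
  have hc''ne : c'' ≠ 0 := fun h => by
    obtain ⟨i, hWi, hCi⟩ := hoff
    rcases Fin.eq_self_or_eq_succAbove (Fin.last 2) i with rfl | ⟨m, rfl⟩
    · rw [hW, Fin.insertNth_apply_same] at hWi
      exact hCi (by rwa [hγ, if_pos hWi] at hγ0)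
    · rw [hW, Fin.insertNth_apply_succAbove] at hWi
      have := congrFun h m
      simp only [hc'', Pi.zero_apply, if_pos hWi] at this
      exact hCi this
  -- THE HYPOTHESIS (slot `i`, `cᵢ ≠ 0`, so `wᵢ = 1`; the drop of the slice `S`) and THE TAME SLICE for `s^{2⌊D/2⌋}·(s^{D%2} G)`
  obtain ⟨i, hci, hdropS⟩ := hdrop c'' hconv hc''ne D G hTfac hG
  have hwi : w i = 1 := le_antisymm (hw1 i) (Nat.pos_of_ne_zero fun h0 => hci (hconv i h0))
  obtain ⟨Φ₂, u, hΦ₂0, hΦ₂det, hu, hg'eq⟩ := tameSlice p hp k 2 (subst Φ b) w c'' hconv (2 * (D / 2)) _ hfac2 i hci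
    (fun h => hp.one_lt.ne' (Nat.dvd_one.mp (hwi ▸ h)))
  rw [subst_X_succAbove_eq_rename] at hg'eq
  set S : MvPowerSeries (Fin 2) k := subst (fun j : Fin 3 => if j = i.succ then (0 : MvPowerSeries (Fin 2) k)
    else X (Fin.predAbove i j)) (X 0 ^ (D % 2) * G) with hS
  have hS0 : S ≠ 0 := by
    intro h0
    rw [h0, map_zero, ← coe_substAlgHom (hasSubst_of_constantCoeff_zero hΦ₂0), map_zero, mul_zero, mul_eq_zero] at hg'eq
    rcases hg'eq with h | h
    · exact pow_ne_zero _ (FormalCoordChange.X_ne_zero' _) h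
    · exact hG (h ▸ dvd_zero _)
  -- `x₂² + S` IS WON (by induction if `S ∈ 𝔪²`, outright otherwise); then climb back along the cylinder
  have hWS : Won k 3 (X (Fin.last 2) ^ 2 + rename (Fin.succAboveEmb (Fin.last 2)) S) := by
    by_cases hSm : constantCoeff S = 0 ∧ ∀ j, coeff (Finsupp.single j 1) S = 0
    · exact ih (κ S) (hα ▸ hdropS S rfl hSm) S rfl hS0 hSm
    · refine (wonBy_zero_of_not_isSingular (by norm_num) ?_).won
      rintro ⟨-, h0, h1⟩
      exact hSm (singular_descends (n := 1) 0 S (by rw [map_zero, zero_add]) h2 ⟨h0, h1⟩).2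
  have hcyl := won_cyl (Fin.castSucc i.succ) hWS
  rw [subst_X_succAbove_eq_rename, rename_cyl_sq] at hcyl
  rw [hγ0, map_zero, zero_add, hg'eq]
  exact won_climb h2 _ hu hΦ₂0 hΦ₂det hcyl

end Summit.ResolutionOfSingularities.ResolutionOfSingularities.Theorems
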